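import Summits.Langlands.Langlands.Theses.ResidualSplit

/-!
# Glue of the generation-1 split of `AutomorphyLifting` (route ResidualSplit, rev 2)

Closes the glue item `stmt-Langlands-26731` of `route-Langlands-ResidualSplit`:
`AutomorphyLifting_of_split : TypeMatchingSat → LiftingOnShape → LiftingOffShape → AutomorphyLifting`.
Pure logic — excluded middle on the inlined Fontaine–Laffaille SHAPE dial of the two lifting cells:
on the dial, `TypeMatchingSat` upgrades the weak residual link to a type-preserving one and
`LiftingOnShape` concludes; off the dial `LiftingOffShape` concludes from the weak link directly.
This is the lens-5 node proof `FLShapeSplit.liftw_of_split` (decomp-langlands, 2026-08-30; certified as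
`FLShapeSplitMock.split_glue` in the node's kit check), transported verbatim to the tree's declarations.
No definitions, no new mathematics.
-/

set_option linter.dupNamespace false -- project-wide option; `Summit.Langlands.Langlands` is the mandated namespace

namespace Summit.Langlands.Langlands.Theorems

open Summit.Langlands.Langlands.Theses.ResidualSplit in
/-- The glue item `stmt-Langlands-26731` of route ResidualSplit (rev 2): the three children
`TypeMatchingSat`, `LiftingOnShape`, `LiftingOffShape` of the split of `AutomorphyLifting` imply the
parent.  Proof: case split on the (inlined, saturated) Fontaine–Laffaille shape dial shared by the two
lifting cells; on the dial the weight-part item supplies the typed link that `LiftingOnShape` needs. -/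
theorem AutomorphyLifting_of_split_proof :
    Summit.Langlands.Langlands.Theses.ResidualSplit.AutomorphyLifting_of_split := by
  intro hT hOn hOff K _ _ n hcpt hn ℓ _ ι ρ hirr hgeo hlink
  exact (Classical.em _).elim
    (fun hG => hOn K n hcpt hn ℓ ι ρ hG hirr hgeo (hT K n hcpt hn ℓ ι ρ hG hirr hgeo hlink))
    (fun hG => hOff K n hcpt hn ℓ ι ρ hG hirr hgeo hlink)

end Summit.Langlands.Langlands.Theorems
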